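import Summits.AtomisticToContinuum.HydrodynamicLimit.Theorems.MourreKoopmanChargesOneBodyCompletenessCampbell
import Summits.AtomisticToContinuum.HydrodynamicLimit.Theorems.MourreKoopmanChargesStressStrongMixingStressFramework
import HarnessLib

/-!
# `OneBodyCompleteness` · line `registered`, stub `normSq_fluct_cellObs_eq` (S0):
# the fluctuation norm of a one-body cell observable under a hard-sphere DLR state of density `σ³`

Support file for the crux item stmt-AtomisticToContinuum-9583 (`OneBodyCompleteness`, route `MourreKoopmanCharges` of
`AtomisticToContinuum/HydrodynamicLimit`), proving the registered sub-goal `normSq_fluct_cellObs_eq`: for fluctuation data `F`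
of the unit-diameter gas whose state is a DLR hard-sphere Gibbs state `IsHardSphereGibbs 1 z 1 0 F.μ` of density `σ³`
(`∫ cellCharge 0 dF.μ = σ³`) and a continuous polynomially bounded `g` with `∫ g M₁ = 0` and `A_g = cellObs g ∈ 𝒱`,

  `‖[A_g]‖²_ℋ = ∫ cov[A_g, A_g ∘ τ_x] dx = σ³ ∫ g² M₁`   (Spohn 1991 Part I §7.1 (7.6)–(7.7)).

Assembly of (S1) the second-order Campbell formula `gibbsCampbellSecondMoment` and (S2) `lintegral_count_eq_mul_volume`
(intensity `= E_μ[#C] · Leb = σ³ · Leb`) of `…OneBodyCompletenessCampbell.lean`, giving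
`cov[A_g, A_g ∘ τ_x] = (∫ g² M₁) · σ³ · vol(C ∩ (C − x))`, `C = [0,1)³`, with (S3) `∫ vol(C ∩ (C − x)) dx = vol(C)² = 1`
(Fubini; `lintegral_volume_unitCell_inter_eq_one`).
-/

noncomputable section

open MeasureTheory ProbabilityTheory Set Filter Topology Function
open scoped InnerProductSpace ENNReal

namespace Summit.AtomisticToContinuum.HydrodynamicLimit.Theorems.MourreKoopmanChargesOneBodyCompleteness

open Literature.Analysis.FluidPDE (IsHardSphereGibbs localMaxwellian IsHardCore)
open Literature.Analysis.FunctionSpaces (PointConfig)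
open Literature.MathematicalPhysics.KineticTheory (V3 MarkedConfig gaussMeasure cellObs cellCharge linStat unitCell
  spatialShift spatialShift_apply measurableSet_unitCell isBounded_unitCell)
open Summit.AtomisticToContinuum.HydrodynamicLimit.Theorems.KiferCompactification (maxwellPhaseMeasure_inv_eq_prod_gaussMeasure
  lintegral_count_le_of_isHardSphereGibbs tsum_ofReal_pow_div_factorial_mul_lt_top measurable_toENNReal_count)
open Summit.AtomisticToContinuum.HydrodynamicLimit.Theorems.MourreKoopmanChargesIdealGasNoDecay (integral_gaussMeasure_eq_integral_mul)
open Summit.AtomisticToContinuum.HydrodynamicLimit.Theorems.MourreKoopmanChargesStressStrongMixing (finsum_mem_one_real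
  integral_cellCharge_zero_eq_toReal_density)

/-- On a configuration with finitely many particles above `D`, the counting statistic `Σ_{p ∈ ω} 1_D(p.1)` is the particle number
`#{p ∈ ω | p.1 ∈ D}`. [folklore] -/
theorem finsum_mem_indicator_fst_eq_toReal_count {D : Set V3} {ω : PointConfig (V3 × V3)}
    (hfin : ((ω : Set (V3 × V3)) ∩ D ×ˢ (univ : Set V3)).Finite) :
    ∑ᶠ p ∈ (ω : Set (V3 × V3)), D.indicator (1 : V3 → ℝ) p.1 = (((ω.count (D ×ˢ (univ : Set V3)) : ℕ∞) : ℝ≥0∞)).toReal := by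
  have h1 : ∑ᶠ p ∈ (ω : Set (V3 × V3)), D.indicator (1 : V3 → ℝ) p.1 =
      ∑ᶠ p ∈ (ω : Set (V3 × V3)), (D ×ˢ (univ : Set V3)).indicator (fun _ => (1 : ℝ)) p := by
    refine finsum_mem_congr rfl fun p _ => ?_
    by_cases hp : p.1 ∈ D
    · rw [Set.indicator_of_mem hp, Set.indicator_of_mem (show p ∈ D ×ˢ (univ : Set V3) from ⟨hp, mem_univ _⟩), Pi.one_apply]
    · rw [Set.indicator_of_notMem hp, Set.indicator_of_notMem (fun h' : p ∈ D ×ˢ (univ : Set V3) => hp h'.1)]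
  rw [h1, finsum_mem_def, Set.indicator_indicator, ← finsum_mem_def, finsum_mem_one_real, PointConfig.count,
    ← PointConfig.coe_eq_carrier, ← hfin.cast_ncard_eq, ENat.toENNReal_coe, ENNReal.toReal_natCast]

/-! ## S3: the autocorrelation of the unit cell -/

/-- **Autocorrelation of the unit cell**: `x ↦ vol([0,1)³ ∩ ([0,1)³ − x))` is measurable and `∫ vol(C ∩ (C − x)) dx = vol(C)² = 1`
(Fubini and translation invariance of Lebesgue measure). [folklore] -/
theorem lintegral_volume_unitCell_inter_eq_one :
    Measurable (fun x : V3 => volume ((unitCell : Set V3) ∩ (· + x) ⁻¹' unitCell)) ∧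
      ∫⁻ x, volume ((unitCell : Set V3) ∩ (· + x) ⁻¹' unitCell) = 1 := by
  have hC : MeasurableSet (unitCell : Set V3) := measurableSet_unitCell
  have hC1 : volume (unitCell : Set V3) = 1 := Literature.MathematicalPhysics.StatisticalMechanics.volume_unitCube
  set f : V3 × V3 → ℝ≥0∞ := fun p => (unitCell : Set V3).indicator 1 p.2 * (unitCell : Set V3).indicator 1 (p.2 + p.1) with hf
  have hfm : Measurable f :=
    ((measurable_one.indicator hC).comp measurable_snd).mul ((measurable_one.indicator hC).comp (measurable_snd.add measurable_fst))
  have h1 : ∀ x : V3, volume ((unitCell : Set V3) ∩ (· + x) ⁻¹' unitCell) = ∫⁻ y, f (x, y) := by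
    intro x
    rw [← lintegral_indicator_one (hC.inter (hC.preimage (measurable_add_const x)))]
    refine lintegral_congr fun y => ?_
    by_cases hy : y ∈ unitCell <;> by_cases hyx : y + x ∈ unitCell <;> simp [hf, hy, hyx]
  simp_rw [h1]
  refine ⟨hfm.lintegral_prod_right', ?_⟩
  rw [lintegral_lintegral_swap (f := fun x y => f (x, y)) hfm.aemeasurable]
  have h2 : ∀ y : V3, ∫⁻ x, f (x, y) = (unitCell : Set V3).indicator 1 y * volume (unitCell : Set V3) := by
    intro y
    simp only [hf]
    rw [lintegral_const_mul _ (show Measurable fun x : V3 => (unitCell : Set V3).indicator (1 : V3 → ℝ≥0∞) (y + x) from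
        (measurable_one.indicator hC).comp (measurable_const_add y)),
      lintegral_add_left_eq_self (fun x => (unitCell : Set V3).indicator (1 : V3 → ℝ≥0∞) x) y, lintegral_indicator_one hC]
  simp_rw [h2]
  rw [lintegral_mul_const _ (measurable_one.indicator hC), lintegral_indicator_one hC, hC1, one_mul]

/-! ## The registered stub -/

/-- **Registered stub `normSq_fluct_cellObs_eq`** (sub-goal S0 of line `registered` of `OneBodyCompleteness`): for fluctuation
data of the unit-diameter hard-sphere gas whose state is a DLR Gibbs state `IsHardSphereGibbs 1 z 1 0` of density `σ³`, and a
continuous polynomially bounded `g` with `∫ g M₁ = 0` and `cellObs g ∈ 𝒱`: `‖[A_g]‖²_ℋ = σ³ ∫ g² M₁` (Campbell second moment,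
translation invariance of the intensity, and `∫ vol(C ∩ (C − x)) dx = 1`). [folklore] -/
theorem normSq_fluct_cellObs_eq : ∀ z σ : ℝ, 0 < z → 0 < σ → ∀ F : Literature.MathematicalPhysics.KineticTheory.HardSphereFluctuationData 1, Literature.Analysis.FluidPDE.IsHardSphereGibbs 1 z 1 (0 : Literature.MathematicalPhysics.KineticTheory.V3) F.μ → (∫ ω, Literature.MathematicalPhysics.KineticTheory.cellCharge 0 ω ∂F.μ = σ ^ 3) → ∀ g : Literature.MathematicalPhysics.KineticTheory.V3 → ℝ, Continuous g → (∃ (C : ℝ) (k : ℕ), ∀ v, |g v| ≤ C * (1 + ‖v‖) ^ k) → Literature.MathematicalPhysics.KineticTheory.cellObs g ∈ F.localObs → (∫ v, g v * Literature.Analysis.FluidPDE.localMaxwellian 1 1 (0 : Literature.MathematicalPhysics.KineticTheory.V3) v = 0) → ‖F.fluct (Literature.MathematicalPhysics.KineticTheory.cellObs g)‖ ^ 2 = σ ^ 3 * ∫ v, g v ^ 2 * Literature.Analysis.FluidPDE.localMaxwellian 1 1 (0 : Literature.MathematicalPhysics.KineticTheory.V3) v := by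
  intro z σ hz hσ F hG hdens g hg hgr hmem hg0
  classical
  obtain ⟨Cg, kg, hgg⟩ := hgr
  have hG' : IsHardSphereGibbs 1 z (1 : ℝ)⁻¹ (0 : V3) F.μ := by rw [inv_one]; exact hG
  have h0 : ∫ v, g v ∂(gaussMeasure (0 : V3) 1) = 0 := by rw [integral_gaussMeasure_eq_integral_mul one_pos]; exact hg0
  set c : ℝ := ∫ v, g v ^ 2 * localMaxwellian 1 1 (0 : V3) v with hc
  have hcc : ∫ v, g v * g v ∂(gaussMeasure (0 : V3) 1) = c := by
    rw [integral_gaussMeasure_eq_integral_mul one_pos, hc]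
    exact integral_congr_ae (ae_of_all _ fun v => by simp only [sq])
  have hC : MeasurableSet (unitCell : Set V3) := measurableSet_unitCell
  have hCb : Bornology.IsBounded (unitCell : Set V3) := isBounded_unitCell
  have hC1 : volume (unitCell : Set V3) = 1 := Literature.MathematicalPhysics.StatisticalMechanics.volume_unitCube
  -- S2: the intensity is `σ³ · Leb`
  have hfinK : ∀ K : Set V3, IsCompact K → ∫⁻ ω, ((ω.count (K ×ˢ (univ : Set V3)) : ℕ∞) : ℝ≥0∞) ∂F.μ ≠ ⊤ := fun K hK => by
    refine ne_top_of_le_ne_top (tsum_ofReal_pow_div_factorial_mul_lt_top hz.le ?_).ne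
      (lintegral_count_le_of_isHardSphereGibbs hG' hK.measurableSet hK.isBounded)
    rw [maxwellPhaseMeasure_inv_eq_prod_gaussMeasure one_pos, ← Set.univ_prod_univ, Measure.prod_prod, Measure.restrict_apply_univ,
      measure_univ, mul_one]
    exact hK.measure_lt_top.ne
  have hρ : ∫⁻ ω, ((ω.count ((unitCell : Set V3) ×ˢ (univ : Set V3)) : ℕ∞) : ℝ≥0∞) ∂F.μ = ENNReal.ofReal (σ ^ 3) := by
    have hcore : ∀ᵐ ω ∂F.μ, IsHardCore 1 ω := F.hardCore.mono fun ω hω p hp q hq hpq => by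
      rw [← dist_eq_norm]; exact hω hp hq hpq
    have h1 := integral_cellCharge_zero_eq_toReal_density one_pos hcore
    rw [hdens] at h1
    have h2 : Literature.MathematicalPhysics.KineticTheory.PointProcess.density F.μ =
        ∫⁻ ω, ((ω.count ((unitCell : Set V3) ×ˢ (univ : Set V3)) : ℕ∞) : ℝ≥0∞) ∂F.μ := by
      simp only [Literature.MathematicalPhysics.KineticTheory.PointProcess.density, ← Set.prod_univ]
      rfl
    have h3 : ∫⁻ ω, ((ω.count ((unitCell : Set V3) ×ˢ (univ : Set V3)) : ℕ∞) : ℝ≥0∞) ∂F.μ ≠ ⊤ :=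
      ne_top_of_le_ne_top (hfinK _ hCb.isCompact_closure) (lintegral_mono fun ω => ENat.toENNReal_le.2
        (PointConfig.count_mono ω (Set.prod_mono subset_closure subset_rfl)))
    rw [← h2] at h3 ⊢
    rw [← ENNReal.ofReal_toReal h3, h1]
  have hS2 : ∀ {B : Set V3}, MeasurableSet B → Bornology.IsBounded B →
      ∫⁻ ω, ((ω.count (B ×ˢ (univ : Set V3)) : ℕ∞) : ℝ≥0∞) ∂F.μ = ENNReal.ofReal (σ ^ 3) * volume B := fun hB hBb => by
    rw [lintegral_count_eq_mul_volume F.measurePreserving_shift hfinK hB hBb, hρ]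
  -- the cell observable as a linear statistic, and its mean
  have hX : ∀ ω : MarkedConfig, cellObs g ω = ∑ᶠ p ∈ (ω : Set (V3 × V3)), (unitCell : Set V3).indicator (1 : V3 → ℝ) p.1 * g p.2 :=
    fun ω => by
    simp only [cellObs, linStat]
    refine finsum_mem_congr rfl fun p _ => ?_
    simp only [Set.indicator_apply, Pi.one_apply]
    split_ifs <;> simp
  have hmean : F.μ[cellObs g] = 0 := by
    have key := integral_windowStat_mul_sub_eq_zero hz one_pos hG' hg continuous_const hgg (e := fun _ => (0 : ℝ)) (Ce := 1) (ke := 0)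
      (fun v => by simp) h0 (by simp) hC hC hCb hCb (-1)
    simp only [mul_zero, finsum_mem_zero, zero_sub, neg_neg, mul_one] at key
    simp_rw [hX]
    exact key
  -- S1 + S2: the covariance with a translate
  have hcov : ∀ x₀ : V3, cov[cellObs g, cellObs g ∘ spatialShift x₀; F.μ] =
      c * (σ ^ 3 * volume.real ((unitCell : Set V3) ∩ (· + x₀) ⁻¹' unitCell)) := by
    intro x₀
    have hC' : MeasurableSet ((· + x₀) ⁻¹' (unitCell : Set V3)) := hC.preimage (measurable_add_const x₀)
    have hC'b : Bornology.IsBounded ((· + x₀) ⁻¹' (unitCell : Set V3)) := (isometry_add_right x₀).antilipschitz.isBounded_preimage hCb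
    set D : Set V3 := (unitCell : Set V3) ∩ (· + x₀) ⁻¹' unitCell with hD
    have hDm : MeasurableSet D := hC.inter hC'
    have hDb : Bornology.IsBounded D := hCb.subset inter_subset_left
    have hY : ∀ ω : MarkedConfig, (cellObs g ∘ spatialShift x₀) ω =
        ∑ᶠ p ∈ (ω : Set (V3 × V3)), ((· + x₀) ⁻¹' (unitCell : Set V3)).indicator (1 : V3 → ℝ) p.1 * g p.2 := fun ω => by
      simp only [Function.comp_apply, spatialShift_apply, cellObs, linStat, PointConfig.coe_eq_carrier, PointConfig.carrier_translate]
      rw [finsum_mem_image (add_left_injective _).injOn]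
      refine finsum_mem_congr rfl fun p _ => ?_
      simp only [Prod.fst_add, Prod.snd_add, add_zero, Set.indicator_apply, Set.mem_preimage, Pi.one_apply]
      split_ifs <;> simp
    -- integrability of the product (two `L²` observables) and of the count
    have hXY : Integrable (fun ω => cellObs g ω * ((cellObs g ∘ spatialShift x₀) ω - F.μ[cellObs g ∘ spatialShift x₀])) F.μ :=
      (F.memLp_of_mem hmem).integrable_mul ((F.memLp_of_mem (F.comp_shift_mem x₀ hmem)).sub (memLp_const _))
    have hNfin : ∫⁻ ω, ((ω.count (D ×ˢ (univ : Set V3)) : ℕ∞) : ℝ≥0∞) ∂F.μ ≠ ⊤ := by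
      rw [hS2 hDm hDb]
      exact ENNReal.mul_ne_top ENNReal.ofReal_ne_top (hDb.measure_lt_top.ne)
    have hNae : (fun ω : MarkedConfig => ∑ᶠ p ∈ (ω : Set (V3 × V3)), D.indicator (1 : V3 → ℝ) p.1) =ᵐ[F.μ]
        fun ω => (((ω.count (D ×ˢ (univ : Set V3)) : ℕ∞) : ℝ≥0∞)).toReal := by
      filter_upwards [ae_lt_top (measurable_toENNReal_count (hDm.prod MeasurableSet.univ)) hNfin] with ω hω
      rw [ENat.toENNReal_lt_top] at hω
      exact finsum_mem_indicator_fst_eq_toReal_count (Set.encard_lt_top_iff.1 hω)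
    have hNint : Integrable (fun ω : MarkedConfig => ∑ᶠ p ∈ (ω : Set (V3 × V3)), D.indicator (1 : V3 → ℝ) p.1) F.μ :=
      (integrable_toReal_of_lintegral_ne_top (measurable_toENNReal_count (hDm.prod MeasurableSet.univ)).aemeasurable hNfin).congr
        hNae.symm
    have hNval : ∫ ω, ∑ᶠ p ∈ (ω : Set (V3 × V3)), D.indicator (1 : V3 → ℝ) p.1 ∂F.μ = σ ^ 3 * volume.real D := by
      rw [integral_congr_ae hNae, integral_toReal (measurable_toENNReal_count (hDm.prod MeasurableSet.univ)).aemeasurable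
        (ae_lt_top (measurable_toENNReal_count (hDm.prod MeasurableSet.univ)) hNfin), hS2 hDm hDb, ENNReal.toReal_mul,
        ENNReal.toReal_ofReal (by positivity), measureReal_def]
    have key := gibbsCampbellSecondMoment 1 z 1 hz one_pos F.μ hG' g g hg hg ⟨Cg, kg, hgg⟩ ⟨Cg, kg, hgg⟩ h0 _ _ hC hC' hCb hC'b
      (F.μ[cellObs g ∘ spatialShift x₀])
    rw [hcc] at key
    simp_rw [← hX, ← hY] at key
    rw [integral_sub hXY (hNint.const_mul c), sub_eq_zero, integral_const_mul, hNval] at key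
    rw [covariance, hmean]
    simp_rw [sub_zero]
    exact key
  -- S3 and assembly
  obtain ⟨hS3m, hS3⟩ := lintegral_volume_unitCell_inter_eq_one
  have hS3' : ∫ x : V3, volume.real ((unitCell : Set V3) ∩ (· + x) ⁻¹' unitCell) = 1 := by
    simp_rw [measureReal_def]
    rw [integral_toReal hS3m.aemeasurable (ae_of_all _ fun x => lt_of_le_of_lt (measure_mono inter_subset_left)
      (by rw [hC1]; exact ENNReal.one_lt_top)), hS3, ENNReal.toReal_one]
  rw [Literature.MathematicalPhysics.KineticTheory.FluctuationStructure.norm_fluct_sq hmem,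
    Literature.MathematicalPhysics.KineticTheory.FluctuationStructure.form_def]
  simp_rw [hcov]
  rw [integral_const_mul, integral_const_mul, hS3', mul_one, mul_comm]

end Summit.AtomisticToContinuum.HydrodynamicLimit.Theorems.MourreKoopmanChargesOneBodyCompleteness

end
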